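import Literature.NumberTheory.EllipticCurves.Kato2004.IwasawaCohomologyEulerSystemLiftComp
import Literature.NumberTheory.EllipticCurves.Kato2004.IntegralH1Corestriction
import HarnessLib

/-!
# Kato 2004 §13.1 / Thm. 13.4: the Λ-adic ZETA CLASS is PINNED — a `ZetaBody` family (Kato's Euler
# system for `T_pW` with its dual-exponential values) defines a UNIQUE element of the pinned
# `𝐇¹_Γ(T_pW)` (`Kato2004.IwasawaH1Data`), for `p` odd and every cyclotomic `ℤ_p`-tower

Topic `NumberTheory/EllipticCurves/Kato2004`.  Seat `bsd-potss-rkm` (prover, cell `bsd-potss`, item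
stmt-BirchSwinnertonDyer-19196 `ReducibleKatoMember`): this file COMPLETES pin P1 of the seat's
realisation spec v3 — "the zeta class pinned by its values" — in the kernel:
* `Kato2004.ZetaBody` (file `EulerSystemValues`; named facts `exists_eulerSystem_expStar_values`
  under `Irr(W[p])` and `exists_member_eulerSystem_expStar_values` at Kato's member, p425804) supplies
  classes `z_{k,r} ∈ H¹(ℚ(μ_{p^k}·∏ℓ), T_pW)` forming an Euler system ((C1), `IsEulerSystem`) that are
  unramified away from `p` at class level ((C2)) and carry Kato's values ((C4)–(C5));
* the `p`-power levels `z_{n+1,∅}` corestrict to the layers `ℚ_n` of any cyclotomic `κ` (`p` odd):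
  `Gal(ℚ̄/ℚ(μ_{p^{n+1}})) ≤ Gal(ℚ̄/ℚ_n)` (`CyclotomicZpExtensionLayerProofs`, p427779; `levelToLayer`,
  p428212);
* the corestricted family is norm-compatible (`coresLe_comp`, p429920; `levelToLayer_layerCores_comm`,
  p430262) and integral (`coresLe_mem_integralH1`, p430870, using that `ℚ(μ_{p^{n+1}})/ℚ` is normal and
  unramified away from `p`: `normal_cyclotomicLevelsRat_level_empty`,
  `cyclotomicLevelsRat_level_empty_unramifiedAt` below);
* hence (`IwasawaH1Data.exists_unique_lift`, the PIN of p417943) a UNIQUE `𝐲 ∈ 𝐇¹_Γ(T_pW)` with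
  `proj n 𝐲 = Cor_{ℚ(μ_{p^{n+1}})/ℚ_n}(z_{n+1,∅})` — `IwasawaH1Data.existsUnique_lift_of_zetaBody`.
This is Kato's sentence "let `Z` be the `Λ`-submodule of `𝐇¹(T)` generated by `(z_{p^n})_n`"
[Thm. 13.4, p. 226] on the `Δ`-trivial component, now an object-level statement of the tree: every
consumer that displayed "`𝐳 ∈ 𝐇¹`" as a hypothesis (kmc's hull readings M1/M1♯ for 19196/19195/19981,
smallim's `DivisibilityInputs.Z` for K6) can take `𝐲` from a `ZetaBody` witness.  HONEST FRAMING: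
nothing asserted beyond the `ZetaBody` hypothesis; no Literature fact minted; no statement about the
VALUES of `𝐲` is made here (they are (C4)–(C5) of the witness at the finite levels); BSD is not advanced.

References: K. Kato, Astérisque 295 (2004) §8.2 (pp. 180–181), §12.2 (p. 220), §13.1 and Thm. 13.4
(pp. 224–226) [Kato2004Asterisque]; L. C. Washington, *Introduction to Cyclotomic Fields* §13.1
[Washington1997]; J. Neukirch, *Algebraic Number Theory* I §9–§10 (unramified primes in cyclotomic
fields, conjugate inertia groups) [Neukirch1999].
-/

noncomputable section

open scoped NumberField TensorProduct
open Field IsDedekindDomain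
open Literature.NumberTheory.GaloisRepresentations
open Literature.NumberTheory.EllipticCurves Literature.NumberTheory.EllipticCurves.Kato2004
open Literature.NumberTheory.EllipticCurves.Kato2004.EulerSystemValues Rat.HeightOneSpectrum

namespace Literature.NumberTheory.EllipticCurves.Kato2004

variable (p : ℕ) [Fact p.Prime]

/-- The `p`-power Euler-system level with no tame primes is `Gal(ℚ̄/ℚ(μ_{p^k}))` (Rubin's `F_k(1) =
K_k`). [cite: Rubin2000, Def. 2.1.1 and Remark 2.1.4] -/
theorem cyclotomicLevelsRat_level_empty (S : Set (HeightOneSpectrum (𝓞 ℚ))) (k : ℕ) :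
    (cyclotomicLevelsRat p S).level k ∅ = rootsOfUnityFixer ℚ (p ^ k) := by
  rw [cyclotomicLevelsRat_level]
  simp

/-- `Gal(ℚ̄/ℚ(μ_{p^k}))` is normal in `Γ_ℚ` (`ℚ(μ_{p^k})/ℚ` is Galois: kernel of the mod-`p^k`
cyclotomic character). [cite: Washington1997, Thm. 2.5 and §13.1] -/
theorem normal_cyclotomicLevelsRat_level_empty (S : Set (HeightOneSpectrum (𝓞 ℚ))) (k : ℕ) :
    ((cyclotomicLevelsRat p S).level k ∅).Normal := by
  haveI : NeZero (p ^ k) := ⟨pow_ne_zero _ (Fact.out : p.Prime).ne_zero⟩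
  rw [cyclotomicLevelsRat_level_empty, rootsOfUnityFixer_eq_ker]
  infer_instance

/-- `ℚ(μ_{p^k})/ℚ` is unramified at every rational prime `v ≠ p`: `I_𝔓 ≤ Gal(ℚ̄/ℚ(μ_{p^k}))` for
`𝔓 ∣ v`. [cite: Washington1997, Prop. 2.3] -/
theorem cyclotomicLevelsRat_level_empty_unramifiedAt (S : Set (HeightOneSpectrum (𝓞 ℚ))) (k : ℕ)
    (v : HeightOneSpectrum (𝓞 ℚ)) (hv : ((primesEquiv v : Nat.Primes) : ℕ) ≠ p) :
    SubgroupIsUnramifiedAt ℚ ((cyclotomicLevelsRat p S).level k ∅) v := by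
  have hp := (Fact.out : p.Prime)
  haveI : NeZero (p ^ k) := ⟨pow_ne_zero _ hp.ne_zero⟩
  rw [cyclotomicLevelsRat_level_empty]
  refine rootsOfUnityFixer_unramifiedAt_of_not_mem ℚ (p ^ k) (Rat.natCast_not_mem_asIdeal_of_not_dvd ?_)
  intro hdvd
  exact hv ((Nat.prime_dvd_prime_iff_eq (primesEquiv v).2 hp).mp ((primesEquiv v).2.dvd_of_dvd_pow hdvd))

variable (W : WeierstrassCurve ℚ) [W.IsElliptic] [ContinuousSMul ℤ_[p] (W.tateModule p)]
  [Module.Free ℤ_[p] (W.tateModule p)] [Module.Finite ℤ_[p] (W.tateModule p)]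
  {κ : ZpExtension ℚ p} (hκ : κ.IsCyclotomic) (hp : p ≠ 2)
  {γ : absoluteGaloisGroup ℚ} (I : IwasawaH1Data W p κ γ)

/-- **The Λ-adic zeta class is PINNED (Kato §13.1 / Thm. 13.4, "`Z` … generated by `(z_{p^n})_n`").**
Let `(κ', Λ', z, x)` satisfy `ZetaBody W p f ι κ' Λ' c d a A z x` (Kato's Euler system for `T_pW` with
its values: named facts `exists_eulerSystem_expStar_values` under `Irr(W[p])`, resp.
`exists_member_eulerSystem_expStar_values` at Kato's member). Then, for `p` odd and any cyclotomic
`ℤ_p`-tower datum `I : IwasawaH1Data W p κ γ`, there is a UNIQUE `𝐲 ∈ 𝐇¹_Γ(T_pW)` whose `n`-th layer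
component is `Cor_{ℚ(μ_{p^{n+1}})/ℚ_n}(z_{n+1,∅})` for every `n`: the Euler-system relations (C1) give
the norm compatibility (`levelToLayer_layerCores_comm`, `coresLe_comp`), the unramifiedness (C2) and
`coresLe_mem_integralH1` (with `ℚ(μ_{p^{n+1}})/ℚ` normal and unramified away from `p`) give the
integrality, and the pin `IwasawaH1Data.exists_unique_lift` gives `𝐲`. No hypothesis beyond the
`ZetaBody` witness; nothing asserted. [cite: Kato2004Asterisque, §13.1 and Thm. 13.4 (pp. 224–226), §12.2 (p. 220), §8.2 (pp. 180–181)] -/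
theorem IwasawaH1Data.existsUnique_lift_of_zetaBody {N : ℕ} (f : CuspForm (CongruenceSubgroup.Gamma0 N) 2)
    (ι : (m : ℕ) → (CyclotomicField m ℚ →+* ℂ)) (κ' : ℝ)
    (Λ' : ∀ (k : ℕ) (r : Finset (HeightOneSpectrum (𝓞 ℚ))),
      H1 (tateRep W p) (cycSubgroup p k r) →ₗ[ℤ_[p]] ℚ_[p] ⊗[ℚ] CyclotomicField (cycLevel p k r) ℚ)
    (c d a : ℤ) (A : ℕ)
    (z : ∀ (k : ℕ) (r : (cyclotomicLevelsRat p (badPlaces c d A N)).Ideals),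
      H1 (tateRep W p) ((cyclotomicLevelsRat p (badPlaces c d A N)).level k r.1))
    (x : ∀ (k : ℕ) (r : (cyclotomicLevelsRat p (badPlaces c d A N)).Ideals),
      CyclotomicField (cycLevel p k r.1) ℚ)
    (hbody : ZetaBody W p f ι κ' Λ' c d a A z x) :
    ∃! y : I.H, ∀ n : ℕ,
      I.proj n y = levelToLayer W p hκ hp (badPlaces c d A N) n
        (z (n + 1) (cyclotomicLevelsRat p (badPlaces c d A N)).idealOne) := by
  refine IwasawaH1Data.existsUnique_lift_of_isEulerSystem_of_integral W p hκ hp I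
    (badPlaces c d A N) z hbody.1 fun n ↦ ?_
  -- integrality of the corestricted class: (C2) + `coresLe_mem_integralH1`
  haveI : ((cyclotomicLevelsRat p (badPlaces c d A N)).level (n + 1) ∅).Normal :=
    normal_cyclotomicLevelsRat_level_empty p (badPlaces c d A N) (n + 1)
  haveI : ((cyclotomicLevelsRat p (badPlaces c d A N)).level (n + 1) ∅).FiniteIndex :=
    finiteIndex_of_isOpen_of_compactSpace _
      ((cyclotomicLevelsRat p (badPlaces c d A N)).isOpen_level (n + 1) ∅)
  haveI : Fintype (κ.layerSubgroup n ⧸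
      ((cyclotomicLevelsRat p (badPlaces c d A N)).level (n + 1) ∅).subgroupOf (κ.layerSubgroup n)) :=
    Fintype.ofFinite _
  have hz : z (n + 1) (cyclotomicLevelsRat p (badPlaces c d A N)).idealOne ∈
      integralH1 (tateRep W p) p ((cyclotomicLevelsRat p (badPlaces c d A N)).level (n + 1) ∅) :=
    fun v hv 𝔓 h𝔓 ↦ hbody.2.1 (n + 1) (cyclotomicLevelsRat p (badPlaces c d A N)).idealOne v hv 𝔓 h𝔓
  have key := coresLe_mem_integralH1 (tateRep W p) p
    (hκ.cyclotomicLevelsRat_level_succ_le_layerSubgroup hp (badPlaces c d A N) n)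
    ((cyclotomicLevelsRat p (badPlaces c d A N)).isOpen_level (n + 1) ∅)
    (fun v hv ↦ cyclotomicLevelsRat_level_empty_unramifiedAt p (badPlaces c d A N) (n + 1) v hv) hz
  unfold levelToLayer
  convert key using 4

end Literature.NumberTheory.EllipticCurves.Kato2004

end
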